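import Summits.HodgeConjecture.HodgeConjecture.Theses.HeckePrymWeil
import Summits.HodgeConjecture.HodgeConjecture.Theorems.HeckePrymWeilWeilTwelvefoldsSqrtMinus7SegreHyperplaneClass
import Literature.AlgebraicGeometry.Motives.SegrePowers
import Literature.AlgebraicGeometry.Motives.ProjectiveSpaceCoordinateEmbedding
import Literature.AlgebraicGeometry.Motives.AbelianVarietyProduct
import Literature.AlgebraicGeometry.Motives.AbelianVarietyProjectiveChart
import Literature.AlgebraicGeometry.HodgeTheory.AbelianVarietyMultiplicationPullback
import Literature.AlgebraicGeometry.HodgeTheory.HolomorphicBundleChernCharacterTopDegree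
import HarnessLib

/-!
# Crux `WeilTwelvefoldsSqrtMinus7` (stmt-HodgeConjecture-1261), line `amnesic-secant-sheaves-split-fourteenfolds` — stub `stub_symmetricSegreEmbedding` (β, r6): the `K`-symmetric weighted Segre embedding of `A × (E × E)`

The GEOMETRIC input of the aiming step of the product trick (E. Markman, *Secant sheaves and Weil
classes on abelian varieties*, arXiv:2509.23403, §11.5 Step 2: the weights `(m₁, m₂)` on the CM surface
`E × E`; R. Hartshorne, *Algebraic Geometry*, II Ex. 5.11–5.12: `σ^*𝒪(1) = 𝒪(1, 1)` for the Segre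
embedding). For a complex abelian variety `(A, φ)` with `φ ≫ φ = -7`, an elliptic curve `E` and a
non-zero rational `η ∈ H²(E(ℂ); ℂ)` we construct (`stub_symmetricSegreEmbedding`, verbatim the
registered stub of the lead's skeleton r6):

* a projective embedding `e_A` of `A` whose hyperplane class `h_A = e_A^* a_A` (`a_A` rational, non-zero)
  is `K`-SYMMETRIC, `φ^* h_A = 7 h_A`: the Segre embedding of `s₆(e₀) × e₀` precomposed with the graph
  `(𝟙, φ) : A → A × A` of `φ`, for any embedding `e₀ : A ↪ ℙᴺ` (`N ≥ 1`) and the Segre–diagonal power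
  `s₆ : ℙᴺ ↪ ℙ^{N₆}` of `Motives/SegrePowers` (class `7 h₀`, `map_segrePow_of_additive`); its class is
  `7h₀ + φ^*h₀`, and `φ^*φ^* = (φ ≫ φ)^* = (-[7])^* = 49` on `H²` (`complexBetti_map_neg_seven_two`:
  `-[7]` acts by `-7` on `H¹` and `H² = H¹ ⌣ H¹`, the tree's `abelianVarietyCohomologyExteriorH1_holds`);
* for all weights `m₁, m₂ ≥ 1`, the Segre embedding `e` of `e_A` with `s_{m₁-1}(e_E) × s_{m₂-1}(e_E)`
  (`e_E : E ↪ ℙᴹ` fixed) and the rational generator `a` of the target, with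
  `e^* a = pr_A^* h_A + s · pr_{E×E}^*(m₁ pr₁^*η + m₂ pr₂^*η)`, where `s ∈ ℚ` is defined by `e_E^* g = s η`
  on the line `H²(E(ℂ); ℂ)` (`exists_eq_ratCast_smul_of_curve`).

All hyperplane-class computations are the Segre additivity `σ(ℂ)^* g = pr₁(ℂ)^* g + pr₂(ℂ)^* g` of
part II (`exists_segreHyperplaneClasses`) plus functoriality. Closed immersions: graphs into separated
targets (`isClosedImmersion_lift_id_left/right`), products (`isClosedImmersion_tensorHom_left`),
Segre (`isClosedImmersion_segreEmbedding_left`), coordinate hyperplanes (`isClosedImmersion_skipMap_left`).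
Everything is proved; no named fact is taken.
-/

noncomputable section

-- every declaration of this problem lives in `Summit.HodgeConjecture.HodgeConjecture.…`
set_option linter.dupNamespace false

open CategoryTheory AlgebraicGeometry MonoidalCategory CartesianMonoidalCategory Function
open Literature.AlgebraicGeometry Literature.AlgebraicGeometry.Motives
  Literature.AlgebraicGeometry.HodgeTheory Literature.AlgebraicTopology.SingularHomology
  Literature.AlgebraicTopology.CharacteristicClasses Literature.NumberTheory.Transcendental

namespace Summit.HodgeConjecture.HodgeConjecture.Theorems.WeilTwelvefoldsSqrtMinus7.AmnesicSecantSheaves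

/-! ## Segre–diagonal powers: closed immersions of class `(d + 1) • g` -/

section SegrePow

/-- `ℙᴺ_ℂ → Spec ℂ` is separated (it is proper). [cite: Hartshorne1977, II.4.9] -/
theorem isSeparated_projectiveSpace_hom (N : ℕ) : IsSeparated (projectiveSpace N ℂ).hom := by
  haveI : IsProper (projectiveSpace N ℂ).hom :=
    Motives.IsSmoothProjective.isProper_holds (isSmoothProjective_projectiveSpace' N)
  infer_instance

/-- The graph `(f, 𝟙) : X ⟶ Y ⊗ X` is a closed immersion for `Y` separated over `ℂ` (a section of the
separated projection `Y ⊗ X → X`). [cite: Hartshorne1977, II Cor. 4.2 and Ex. 4.8] -/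
theorem isClosedImmersion_lift_id_right {X Y : SchemeOver ℂ} (f : X ⟶ Y) [IsSeparated Y.hom] :
    IsClosedImmersion (CartesianMonoidalCategory.lift f (𝟙 X)).left := by
  have h : (CartesianMonoidalCategory.lift f (𝟙 X)).left ≫ (snd Y X).left = 𝟙 _ := by
    rw [← Over.comp_left, CartesianMonoidalCategory.lift_snd]
    rfl
  haveI : IsSeparated (snd Y X).left := inferInstanceAs (IsSeparated (Limits.pullback.snd Y.hom X.hom))
  haveI : IsClosedImmersion ((CartesianMonoidalCategory.lift f (𝟙 X)).left ≫ (snd Y X).left) := by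
    rw [h]; infer_instance
  exact IsClosedImmersion.of_comp _ (snd Y X).left

/-- The graph `(𝟙, f) : X ⟶ X ⊗ Y` is a closed immersion for `Y` separated over `ℂ` (a section of the
separated projection `X ⊗ Y → X`). [cite: Hartshorne1977, II Cor. 4.2 and Ex. 4.8] -/
theorem isClosedImmersion_lift_id_left {X Y : SchemeOver ℂ} (f : X ⟶ Y) [IsSeparated Y.hom] :
    IsClosedImmersion (CartesianMonoidalCategory.lift (𝟙 X) f).left := by
  have h : (CartesianMonoidalCategory.lift (𝟙 X) f).left ≫ (fst X Y).left = 𝟙 _ := by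
    rw [← Over.comp_left, CartesianMonoidalCategory.lift_fst]
    rfl
  haveI : IsSeparated (fst X Y).left := inferInstanceAs (IsSeparated (Limits.pullback.fst X.hom Y.hom))
  haveI : IsClosedImmersion ((CartesianMonoidalCategory.lift (𝟙 X) f).left ≫ (fst X Y).left) := by
    rw [h]; infer_instance
  exact IsClosedImmersion.of_comp _ (fst X Y).left

/-- **The Segre–diagonal maps `s_d : ℙᴺ ⟶ ℙ^{N_d}` are closed immersions** (graph of `s_{d-1}`, then
Segre). [cite: Hartshorne1977, II Ex. 4.9 and Ex. 5.11] -/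
theorem isClosedImmersion_segrePow_left (N : ℕ) : ∀ d : ℕ, IsClosedImmersion (ProjectiveSpace.segrePow N ℂ d).left
  | 0 => by
    change IsClosedImmersion (𝟙 (projectiveSpace N ℂ) : projectiveSpace N ℂ ⟶ projectiveSpace N ℂ).left
    exact inferInstanceAs (IsClosedImmersion (𝟙 (projectiveSpace N ℂ).left))
  | d + 1 => by
    haveI := isClosedImmersion_segrePow_left N d
    haveI := isSeparated_projectiveSpace_hom (ProjectiveSpace.segrePowDim N d)
    haveI := isClosedImmersion_lift_id_right (ProjectiveSpace.segrePow N ℂ d)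
    change IsClosedImmersion ((CartesianMonoidalCategory.lift (ProjectiveSpace.segrePow N ℂ d) (𝟙 _)).left ≫
      (segreEmbedding (ProjectiveSpace.segrePowDim N d) N ℂ).left)
    infer_instance

/-- **`s_d^* g = (d + 1) • g` on `H²`** for any Segre-additive family of classes `g` (induction along
`s_{d+1} = (s_d, 𝟙) ≫ σ`). [cite: Hartshorne1977, I Ex. 2.12 and II Ex. 5.11] -/
theorem map_segrePow_of_additive (g : (N : ℕ) → complexBetti (projectiveSpace N ℂ) 2)
    (hg : ∀ n m : ℕ, complexBetti.map (segreEmbedding n m ℂ) 2 (g (n * m + n + m)) =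
      complexBetti.map (fst (projectiveSpace n ℂ) (projectiveSpace m ℂ)) 2 (g n) +
        complexBetti.map (snd (projectiveSpace n ℂ) (projectiveSpace m ℂ)) 2 (g m))
    (N : ℕ) : ∀ d : ℕ, complexBetti.map (ProjectiveSpace.segrePow N ℂ d) 2 (g (ProjectiveSpace.segrePowDim N d)) =
      ((d + 1 : ℕ) : ℂ) • g N
  | 0 => by
    change complexBetti.map (𝟙 (projectiveSpace N ℂ)) 2 (g N) = _
    rw [complexBetti.map_id, Nat.zero_add, Nat.cast_one, one_smul]
    rfl
  | d + 1 => by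
    change complexBetti.map (CartesianMonoidalCategory.lift (ProjectiveSpace.segrePow N ℂ d) (𝟙 _) ≫
      segreEmbedding (ProjectiveSpace.segrePowDim N d) N ℂ) 2 (g (ProjectiveSpace.segrePowDim N d * N +
        ProjectiveSpace.segrePowDim N d + N)) = _
    rw [complexBetti.map_comp, ModuleCat.comp_apply, hg, map_add, ← ModuleCat.comp_apply, ← complexBetti.map_comp,
      CartesianMonoidalCategory.lift_fst, ← ModuleCat.comp_apply, ← complexBetti.map_comp,
      CartesianMonoidalCategory.lift_snd, complexBetti.map_id, ModuleCat.id_apply, map_segrePow_of_additive g hg N d]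
    simp only [Nat.cast_add, Nat.cast_one, add_smul, one_smul]

end SegrePow

/-! ## `(-[7])^* = 49` on `H²` of an abelian variety -/

/-- **`(-(7 • 𝟙))^* = 49` on `H²(A(ℂ); ℂ)`**: on `H¹` the homomorphism `-(7 • 𝟙)` acts by `-7`
(additivity of `f ↦ f^*|_{H¹}`), and `H²` is spanned by cup products of degree-one classes.
[cite: MumfordAV1970, §1 (3) and §19] -/
theorem complexBetti_map_neg_seven_two (A : AbelianVariety ℂ) (y : complexBetti A.X 2) :
    complexBetti.map (-((7 : ℤ) • 𝟙 A)).hom.hom.hom 2 y = (49 : ℂ) • y := by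
  have hφ : -((7 : ℤ) • 𝟙 A) = (-7 : ℤ) • 𝟙 A + (0 : ℤ) • 𝟙 A := by rw [zero_smul, add_zero, neg_smul]
  have hone : ∀ c : complexBetti A.X 1, complexBetti.map (-((7 : ℤ) • 𝟙 A)).hom.hom.hom 1 c = (-7 : ℂ) • c := by
    intro c
    rw [hφ, complexBetti_map_zsmul_id_add_zsmul_one]
    simp
  have key : ∀ v : Fin 2 → complexBetti A.X 1,
      complexBetti.map (-((7 : ℤ) • 𝟙 A)).hom.hom.hom 2 (cupPowOne ℂ (ComplexPoints A.X) 2 v) =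
        (49 : ℂ) • cupPowOne ℂ (ComplexPoints A.X) 2 v := by
    intro v
    rw [complexBetti_map_cupPowOne]
    have hv : (fun i ↦ complexBetti.map (-((7 : ℤ) • 𝟙 A)).hom.hom.hom 1 (v i)) = fun i ↦ (-7 : ℂ) • v i :=
      funext fun i ↦ hone (v i)
    rw [hv, MultilinearMap.map_smul_univ, Finset.prod_const, Finset.card_univ, Fintype.card_fin]
    norm_num
  have hspan := (abelianVarietyCohomologyExteriorH1_holds.hasExteriorCohomologyH1 A).span_range_cupPowOne 2
  have hy : y ∈ Submodule.span ℂ (Set.range (cupPowOne ℂ (ComplexPoints A.X) 2)) := by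
    rw [hspan]; exact Submodule.mem_top
  induction hy using Submodule.span_induction with
  | mem x hx =>
    obtain ⟨v, rfl⟩ := hx
    exact key v
  | zero => rw [map_zero, smul_zero]
  | add a b _ _ ha hb => rw [map_add, smul_add, ha, hb]
  | smul r a _ ha => rw [map_smul, ha, smul_comm]

/-! ## Projective embeddings of abelian varieties into `ℙᴺ`, `N ≥ 1` -/

/-- Every complex abelian variety admits a closed immersion into some `ℙᴺ_ℂ` with `N ≥ 1` (abelian
varieties are projective; bump the dimension by a coordinate hyperplane embedding).
[cite: MumfordAV1970, §6 Application 1 (p. 62)] -/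
theorem exists_closedImmersion_projectiveSpace_pos (A : AbelianVariety ℂ) :
    ∃ (N : ℕ) (ι : A.X ⟶ projectiveSpace N ℂ), 1 ≤ N ∧ IsClosedImmersion ι.left := by
  obtain ⟨n, ι, hι⟩ := (Motives.AbelianVariety.isSmoothProjective_holds (A := A)).isProjectiveOver
  refine ⟨n + 1, ι ≫ ProjectiveSpace.skipMap (k := ℂ) (0 : Fin (n + 2)), by omega, ?_⟩
  change IsClosedImmersion (ι.left ≫ (ProjectiveSpace.skipMap (k := ℂ) (0 : Fin (n + 2))).left)
  infer_instance

/-- On a curve, a rational class of `H²` is a rational multiple of any non-zero rational class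
(`dim H²(E(ℂ); ℂ) = 1`). [cite: VoisinHodgeI2002, §7.1.1] -/
theorem exists_eq_ratCast_smul_of_curve (E : AbelianVariety ℂ) (hE : E.dim = 1) {η : complexBetti E.X 2}
    (hη : IsRationalClass η) (hη0 : η ≠ 0) {c : complexBetti E.X 2} (hc : IsRationalClass c) :
    ∃ s : ℚ, c = ((s : ℚ) : ℂ) • η := by
  have hE1 : Motives.IsSmoothProjective 1 E.X := hE ▸ Motives.AbelianVariety.isSmoothProjective_holds
  have h1 : Module.finrank ℂ (complexBetti E.X 2) = 1 := finrank_complexBetti_two_mul_eq_one hE1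
  obtain ⟨t, ht⟩ := (finrank_eq_one_iff_of_nonzero' η hη0).1 h1 c
  obtain ⟨q, hq⟩ := WeilTwelvefoldsSqrtMinus7.AmnesicSecantSheaves.exists_ratCast_eq_of_isRationalClass_smul hη hη0
    (z := t) (by rw [ht]; exact hc)
  exact ⟨q, by rw [hq, ht]⟩

/-! ## Functoriality bookkeeping on `H•(–(ℂ); ℂ)` -/

section Bookkeeping

variable {T X Y X' Y' Z : SchemeOver ℂ}

/-- `(f ≫ g)^* x = f^* (g^* x)`. [folklore] -/
theorem map_comp_apply' (f : X ⟶ Y) (g : Y ⟶ Z) (i : ℕ) (x : complexBetti Z i) :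
    complexBetti.map (f ≫ g) i x = complexBetti.map f i (complexBetti.map g i x) := by
  rw [complexBetti.map_comp, ModuleCat.comp_apply]

/-- `(f ⊗ g)^* pr₁^* x = pr₁^* f^* x`. [folklore] -/
theorem map_tensorHom_map_fst (f : X ⟶ X') (g : Y ⟶ Y') (i : ℕ) (x : complexBetti X' i) :
    complexBetti.map (f ⊗ₘ g) i (complexBetti.map (fst X' Y') i x) = complexBetti.map (fst X Y) i (complexBetti.map f i x) := by
  rw [← map_comp_apply', CartesianMonoidalCategory.tensorHom_fst, map_comp_apply']

/-- `(f ⊗ g)^* pr₂^* y = pr₂^* g^* y`. [folklore] -/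
theorem map_tensorHom_map_snd (f : X ⟶ X') (g : Y ⟶ Y') (i : ℕ) (y : complexBetti Y' i) :
    complexBetti.map (f ⊗ₘ g) i (complexBetti.map (snd X' Y') i y) = complexBetti.map (snd X Y) i (complexBetti.map g i y) := by
  rw [← map_comp_apply', CartesianMonoidalCategory.tensorHom_snd, map_comp_apply']

/-- `(f, g)^* pr₁^* x = f^* x`. [folklore] -/
theorem map_lift_map_fst (f : T ⟶ X) (g : T ⟶ Y) (i : ℕ) (x : complexBetti X i) :
    complexBetti.map (CartesianMonoidalCategory.lift f g) i (complexBetti.map (fst X Y) i x) = complexBetti.map f i x := by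
  rw [← map_comp_apply', CartesianMonoidalCategory.lift_fst]

/-- `(f, g)^* pr₂^* y = g^* y`. [folklore] -/
theorem map_lift_map_snd (f : T ⟶ X) (g : T ⟶ Y) (i : ℕ) (y : complexBetti Y i) :
    complexBetti.map (CartesianMonoidalCategory.lift f g) i (complexBetti.map (snd X Y) i y) = complexBetti.map g i y := by
  rw [← map_comp_apply', CartesianMonoidalCategory.lift_snd]

end Bookkeeping

/-! ## The stub -/

/-- **Stub β (r6) — the `K`-symmetric weighted Segre embedding of `A × (E × E)`.** For `(A, φ)` with
`φ ≫ φ = -7`, a complex elliptic curve `E` and a non-zero rational `η ∈ H²(E(ℂ); ℂ)`: a projective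
embedding `e_A` of `A` and a non-zero rational `a_A ∈ H²(ℙᴺ(ℂ))` whose hyperplane class
`h_A = e_A^* a_A` is `K`-symmetric, `φ^* h_A = 7 h_A` (the Segre embedding of the graph of `φ` in
`s₆(e₀) × e₀`, class `7h₀ + φ^*h₀`, with `φ^*φ^* = (-[7])^* = 49` on `H²`), and a rational `s` such
that for all weights `m₁, m₂ ≥ 1` the Segre embedding of `e_A` with `s_{m₁-1}(e_E) × s_{m₂-1}(e_E)`
has hyperplane class `pr_A^* h_A + s · pr_{E×E}^*(m₁ pr₁^* η + m₂ pr₂^* η)` (Segre additivity on `H²`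
of complex points, `exists_segreHyperplaneClasses`; `s_d^* g = (d+1) g`; `e_E^* g = s η` on the line
`H²(E(ℂ); ℂ)`). [cite: Hartshorne1977, II Ex. 5.11 and Ex. 5.12] [cite: Markman2025SurveySecant, §11.5 Step 2] -/
theorem stub_symmetricSegreEmbedding :
    ∀ (A : AbelianVariety ℂ) (φ : A ⟶ A), φ ≫ φ = -((7 : ℤ) • 𝟙 A) →
    ∀ (E : AbelianVariety ℂ), E.dim = 1 →
    ∀ (η : complexBetti E.X 2), IsRationalClass η → η ≠ 0 →
    ∃ (eA : ProjectiveEmbedding A.X) (aA : complexBetti (projectiveSpace eA.n ℂ) 2) (s : ℚ),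
      IsRationalClass aA ∧ aA ≠ 0 ∧
      complexBetti.map φ.hom.hom.hom 2 (complexBetti.map eA.ι 2 aA) = (7 : ℂ) • complexBetti.map eA.ι 2 aA ∧
      ∀ (m₁ m₂ : ℕ), 0 < m₁ → 0 < m₂ →
        ∃ (e : ProjectiveEmbedding (A.prod (E.prod E)).X) (a : complexBetti (projectiveSpace e.n ℂ) 2),
          IsRationalClass a ∧ a ≠ 0 ∧
          complexBetti.map e.ι 2 a =
            complexBetti.map (AbelianVariety.fst A (E.prod E)).hom.hom.hom 2 (complexBetti.map eA.ι 2 aA) +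
            ((s : ℚ) : ℂ) • complexBetti.map (AbelianVariety.snd A (E.prod E)).hom.hom.hom 2
              (((m₁ : ℕ) : ℂ) • complexBetti.map (AbelianVariety.fst E E).hom.hom.hom 2 η +
                ((m₂ : ℕ) : ℂ) • complexBetti.map (AbelianVariety.snd E E).hom.hom.hom 2 η) := by
  intro A φ hφ E hE η hη hη0
  obtain ⟨g, hgr, hgnz, hgσ⟩ := exists_segreHyperplaneClasses
  obtain ⟨N, e₀, hN, he₀⟩ := exists_closedImmersion_projectiveSpace_pos A
  obtain ⟨M, f₀, hM, hf₀⟩ := exists_closedImmersion_projectiveSpace_pos E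
  haveI := he₀
  haveI := hf₀
  -- the `K`-symmetric embedding of `A`: graph of `φ`, then `s₆(e₀) × e₀`, then Segre
  obtain ⟨ιA, hιA⟩ : ∃ ι : A.X ⟶ projectiveSpace (ProjectiveSpace.segrePowDim N 6 * N + ProjectiveSpace.segrePowDim N 6 + N) ℂ,
      ι = CartesianMonoidalCategory.lift (𝟙 A.X) φ.hom.hom.hom ≫
        ((e₀ ≫ ProjectiveSpace.segrePow N ℂ 6) ⊗ₘ e₀) ≫ segreEmbedding (ProjectiveSpace.segrePowDim N 6) N ℂ := ⟨_, rfl⟩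
  haveI := isClosedImmersion_segrePow_left N 6
  haveI : IsClosedImmersion (e₀ ≫ ProjectiveSpace.segrePow N ℂ 6).left := by
    change IsClosedImmersion (e₀.left ≫ (ProjectiveSpace.segrePow N ℂ 6).left); infer_instance
  haveI := isClosedImmersion_tensorHom_left (e₀ ≫ ProjectiveSpace.segrePow N ℂ 6) e₀
  haveI := isClosedImmersion_lift_id_left (X := A.X) (Y := A.X) φ.hom.hom.hom
  haveI hιAci : IsClosedImmersion ιA.left := by
    rw [hιA]
    change IsClosedImmersion ((CartesianMonoidalCategory.lift (𝟙 A.X) φ.hom.hom.hom).left ≫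
      (((e₀ ≫ ProjectiveSpace.segrePow N ℂ 6) ⊗ₘ e₀).left ≫ (segreEmbedding (ProjectiveSpace.segrePowDim N 6) N ℂ).left))
    infer_instance
  let eA : ProjectiveEmbedding A.X := ⟨_, ιA, hιAci⟩
  obtain ⟨h₀, hh₀⟩ : ∃ h : complexBetti A.X 2, h = complexBetti.map e₀ 2 (g N) := ⟨_, rfl⟩
  have hA : complexBetti.map ιA 2 (g (ProjectiveSpace.segrePowDim N 6 * N + ProjectiveSpace.segrePowDim N 6 + N)) =
      (7 : ℂ) • h₀ + complexBetti.map φ.hom.hom.hom 2 h₀ := by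
    rw [hιA, map_comp_apply', map_comp_apply', hgσ (ProjectiveSpace.segrePowDim N 6) N, map_add, map_add,
      map_tensorHom_map_fst, map_tensorHom_map_snd, map_lift_map_fst, map_lift_map_snd, complexBetti.map_id,
      ModuleCat.id_apply, map_comp_apply', map_segrePow_of_additive g hgσ N 6, map_smul, ← hh₀]
    norm_num
  -- the curve: `f₀^* g = s • η`
  obtain ⟨s, hs⟩ := exists_eq_ratCast_smul_of_curve E hE hη hη0 ((hgr M).pullback (AlgPoints.mapContinuous (L := ℂ) f₀))
  have hKA : 1 ≤ ProjectiveSpace.segrePowDim N 6 * N + ProjectiveSpace.segrePowDim N 6 + N := le_trans hN (Nat.le_add_left _ _)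
  refine ⟨eA, g _, s, hgr _, hgnz _ hKA, ?_, fun m₁ m₂ hm₁ hm₂ ↦ ?_⟩
  · -- `φ^* h_A = 7 h_A`
    change complexBetti.map φ.hom.hom.hom 2
        (complexBetti.map ιA 2 (g (ProjectiveSpace.segrePowDim N 6 * N + ProjectiveSpace.segrePowDim N 6 + N))) =
      (7 : ℂ) • complexBetti.map ιA 2 (g (ProjectiveSpace.segrePowDim N 6 * N + ProjectiveSpace.segrePowDim N 6 + N))
    have hcomp : φ.hom.hom.hom ≫ φ.hom.hom.hom = (φ ≫ φ).hom.hom.hom := rfl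
    rw [hA, map_add, map_smul, ← map_comp_apply', hcomp, hφ, complexBetti_map_neg_seven_two, smul_add, smul_smul,
      add_comm]
    norm_num
  · -- the weighted Segre embedding of `A × (E × E)`
    obtain ⟨d₁, rfl⟩ : ∃ d, m₁ = d + 1 := ⟨m₁ - 1, by omega⟩
    obtain ⟨d₂, rfl⟩ : ∃ d, m₂ = d + 1 := ⟨m₂ - 1, by omega⟩
    obtain ⟨ιE, hιE⟩ : ∃ ι : E.X ⊗ E.X ⟶ projectiveSpace (ProjectiveSpace.segrePowDim M d₁ * ProjectiveSpace.segrePowDim M d₂ +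
        ProjectiveSpace.segrePowDim M d₁ + ProjectiveSpace.segrePowDim M d₂) ℂ,
        ι = ((f₀ ≫ ProjectiveSpace.segrePow M ℂ d₁) ⊗ₘ (f₀ ≫ ProjectiveSpace.segrePow M ℂ d₂)) ≫
          segreEmbedding (ProjectiveSpace.segrePowDim M d₁) (ProjectiveSpace.segrePowDim M d₂) ℂ := ⟨_, rfl⟩
    haveI := isClosedImmersion_segrePow_left M d₁
    haveI := isClosedImmersion_segrePow_left M d₂
    haveI : IsClosedImmersion (f₀ ≫ ProjectiveSpace.segrePow M ℂ d₁).left := by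
      change IsClosedImmersion (f₀.left ≫ (ProjectiveSpace.segrePow M ℂ d₁).left); infer_instance
    haveI : IsClosedImmersion (f₀ ≫ ProjectiveSpace.segrePow M ℂ d₂).left := by
      change IsClosedImmersion (f₀.left ≫ (ProjectiveSpace.segrePow M ℂ d₂).left); infer_instance
    haveI := isClosedImmersion_tensorHom_left (X := E.X) (Y := E.X) (f₀ ≫ ProjectiveSpace.segrePow M ℂ d₁)
      (f₀ ≫ ProjectiveSpace.segrePow M ℂ d₂)
    haveI hιEci : IsClosedImmersion ιE.left := by
      rw [hιE]
      change IsClosedImmersion (((f₀ ≫ ProjectiveSpace.segrePow M ℂ d₁) ⊗ₘ (f₀ ≫ ProjectiveSpace.segrePow M ℂ d₂)).left ≫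
        (segreEmbedding (ProjectiveSpace.segrePowDim M d₁) (ProjectiveSpace.segrePowDim M d₂) ℂ).left)
      infer_instance
    obtain ⟨ι, hι⟩ : ∃ ι : A.X ⊗ (E.X ⊗ E.X) ⟶ projectiveSpace
        ((ProjectiveSpace.segrePowDim N 6 * N + ProjectiveSpace.segrePowDim N 6 + N) *
          (ProjectiveSpace.segrePowDim M d₁ * ProjectiveSpace.segrePowDim M d₂ + ProjectiveSpace.segrePowDim M d₁ +
            ProjectiveSpace.segrePowDim M d₂) +
          (ProjectiveSpace.segrePowDim N 6 * N + ProjectiveSpace.segrePowDim N 6 + N) +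
          (ProjectiveSpace.segrePowDim M d₁ * ProjectiveSpace.segrePowDim M d₂ + ProjectiveSpace.segrePowDim M d₁ +
            ProjectiveSpace.segrePowDim M d₂)) ℂ,
        ι = (ιA ⊗ₘ ιE) ≫ segreEmbedding _ _ ℂ := ⟨_, rfl⟩
    haveI := isClosedImmersion_tensorHom_left (X := A.X) (Y := E.X ⊗ E.X) ιA ιE
    have hιci : IsClosedImmersion ι.left := by
      rw [hι]
      change IsClosedImmersion ((ιA ⊗ₘ ιE).left ≫ (segreEmbedding _ _ ℂ).left)
      infer_instance
    have hKK : 1 ≤ (ProjectiveSpace.segrePowDim N 6 * N + ProjectiveSpace.segrePowDim N 6 + N) *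
          (ProjectiveSpace.segrePowDim M d₁ * ProjectiveSpace.segrePowDim M d₂ + ProjectiveSpace.segrePowDim M d₁ +
            ProjectiveSpace.segrePowDim M d₂) +
          (ProjectiveSpace.segrePowDim N 6 * N + ProjectiveSpace.segrePowDim N 6 + N) +
          (ProjectiveSpace.segrePowDim M d₁ * ProjectiveSpace.segrePowDim M d₂ + ProjectiveSpace.segrePowDim M d₁ +
            ProjectiveSpace.segrePowDim M d₂) :=
      le_trans hKA ((Nat.le_add_left _ _).trans (Nat.le_add_right _ _))
    refine ⟨⟨_, ι, hιci⟩, g _, hgr _, hgnz _ hKK, ?_⟩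
    -- `ι_E^* g = m₁ pr₁^* (f₀^* g) + m₂ pr₂^* (f₀^* g)`
    have hEcl : complexBetti.map ιE 2 (g _) =
        ((d₁ + 1 : ℕ) : ℂ) • complexBetti.map (fst E.X E.X) 2 (complexBetti.map f₀ 2 (g M)) +
          ((d₂ + 1 : ℕ) : ℂ) • complexBetti.map (snd E.X E.X) 2 (complexBetti.map f₀ 2 (g M)) := by
      rw [hιE, map_comp_apply', hgσ (ProjectiveSpace.segrePowDim M d₁) (ProjectiveSpace.segrePowDim M d₂), map_add,
        map_tensorHom_map_fst, map_tensorHom_map_snd, map_comp_apply', map_comp_apply',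
        map_segrePow_of_additive g hgσ M d₁, map_segrePow_of_additive g hgσ M d₂]
      simp only [map_smul]
    have final : complexBetti.map ι 2 (g _) =
        complexBetti.map (fst A.X (E.X ⊗ E.X)) 2
            (complexBetti.map ιA 2 (g (ProjectiveSpace.segrePowDim N 6 * N + ProjectiveSpace.segrePowDim N 6 + N))) +
          ((s : ℚ) : ℂ) • complexBetti.map (snd A.X (E.X ⊗ E.X)) 2
            (((d₁ + 1 : ℕ) : ℂ) • complexBetti.map (fst E.X E.X) 2 η + ((d₂ + 1 : ℕ) : ℂ) • complexBetti.map (snd E.X E.X) 2 η) := by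
      rw [hι, map_comp_apply', hgσ, map_add, map_tensorHom_map_fst, map_tensorHom_map_snd, hEcl, hs]
      simp only [map_add, map_smul, smul_add, smul_smul, mul_comm]
    exact final

end Summit.HodgeConjecture.HodgeConjecture.Theorems.WeilTwelvefoldsSqrtMinus7.AmnesicSecantSheaves

end
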